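import Summits.QuantumFields.YangMills.Theorems.BalabanUVNodesN15BumpCoverTwoGrid
import Summits.QuantumFields.YangMills.Theorems.BalabanUVNodesN15VectorCarrier
import HarnessLib

/-!
# THE SMOOTH CUT-OFF WITH A PLATEAU, VII: THE BUMP AT THE COVER ON THE COLOUR-LIFTED CARRIER `(Tor (fine n M) × Fin (d+1)) × ι` — files 44∕45∕47∕48's LITERAL bump rows
# (`fun p => χ̃_k p.1`, shifts `liftEquiv (bshiftEquiv M n μ) ι`, pairing `liftMap (kingPrV L k r M) ι`, cut `fun p => χ_k p.1`, partition `fun p => h_k p.1`): `hdχt`∕`hdχtb`, the ten cut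
# identities, `hL`, `hfit₁`∕`hfit₁b`∕`hfit₂`∕`hfit₂b` (dag-n15-w4 g4, width seat on N15 = NE2; the lifted producer for the (r3) assembly)

Cell `pub-ymgap`, seat `pub-ymgap-dag-n15-w4` (director №399 (3a) width; HUMAN RULING D-0062), generation 4.  `bears_on: R4∕N15 · K3⁸ SpineGivenEndpointR13SepCoPHV
(stmt-QuantumFields-27366)`.  Filed `--supports stmt-QuantumFields-27366 --as helper` — COUNT-NEUTRAL.  Theorems only (0 `def`, 0 `sorry`).  Imports BY NAME this seat's FILES V∕VI
`…N15BumpCover` ∕ `…N15BumpCoverTwoGrid` (the bond-carrier rows; through them FILES II∕III and dag-n15-c FILES 66∕67∕72) and dag-n15-b `…N15VectorCarrier` (`liftEquiv`, `liftMap`).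
Nothing in the tree is modified.

WHY.  dag-n15-w3's dressed cubes live on the product carrier `X × ι` (`ι` the colour∕matrix index): files 44∕45∕47∕48 display the bump as `fun p : X × ι => χtX k p.1` with the lifted
shifts `liftEquiv (τ μ) ι` and the lifted pairing `liftMap π ι`.  At dag-n15-c's cover `X = Tor (fine n M) × Fin (d+1)`, `τ μ = bshiftEquiv M n μ`, `π = kingPrV L k r M`,
`χtX k = bcube (2q) (coverXi M n w) R k`, `χX k = chiCube M n (coverCorner M w q m₀ k) S`, `hX k = hcube (2q) (coverXi M n w) k`.  FILE II∕III are carrier-generic, and the lifted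
coordinates `ξ_ν(p) := coverXi M n w ν p.1` inherit FILE 66∕67's data through the first factor (§1); so every lifted row is ONE application of FILE II∕III (the function
`bcube (2q) (fun ν p => coverXi M n w ν p.1) R k` IS `fun p => χ̃_k p.1`, FILE II `bcube_comp_fst`), with FILE V's window lemma discharging the cut hypothesis.
* §1 `coverXi_shift_lift`, `coverXi_offset_lift`, ★ `chiCube_cover_lift_eq_one_of_near_bbox`.
* §2 ★ `abs_fgrad_bcube_cover_lift_le` ∕ `abs_bgrad_bcube_cover_lift_le` (`hdχt`∕`hdχtb ≤ π∕w`); the ten cut identities `bcube_cover_lift_cut`, `cut_bcube_cover_lift`,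
  `bcube_cover_lift_comp_shift_cut`, `cut_bcube_cover_lift_comp_shift`, `bcube_cover_lift_comp_shift_symm_cut`, `cut_bcube_cover_lift_comp_shift_symm`, `fgrad_bcube_cover_lift_cut`,
  `cut_fgrad_bcube_cover_lift`, `bgrad_bcube_cover_lift_cut`, `cut_bgrad_bcube_cover_lift`; ★★★ `mulOp_coverH_lift_comp_lapOp_comp_one_sub_bcube_cover_lift` (files 44∕47's `hL` given
  the displayed `W`-locality) + `…_lapOp_mulOp_…` (hypothesis-free for `W = M_v`).
* §3 two spacings: ★★ `abs_bcube_cover_lift_shift_fine_sub_le` ∕ `abs_bcube_cover_lift_shift_symm_fine_sub_le` (`hfit₁`∕`hfit₁b`, common letter `2π(d+1)∕(L^k w)` available via FILE VI),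
  ★★★ `abs_fgrad_bcube_cover_lift_two_grid_le` ∕ `abs_bgrad_bcube_cover_lift_two_grid_le` (`hfit₂`∕`hfit₂b ≤ w⁻¹(L^k w)⁻¹(32π⁴ + π²(d+1))`).

HONEST FRAMING ∕ LIMITS.  Plumbing over LANDED FILES II∕III∕V∕VI (first-factor readings); no operator estimate; the knit's parameters displayed, not chosen; [B9] (3.62)–(3.65)
pp.402–403, Thm 3.14 pp.426–427 = SHAPES ∕ template only — nothing of [B5]∕[B6]∕[B9] asserted.  `U ≡ 1` doubled-cube torus MODEL geometry.  NE2⁺ NOT PRINTED, NOT proved; N15 NOT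
discharged; counts of record UNMOVED (typed 28∕28 · discharged 5∕27); one finite 𝕋⁴ at fixed ε — NOT infinite volume, NOT OS on ℝ⁴, NOT a mass gap, NOT Clay; R4 closes the
conditional finite-𝕋⁴ rung `BalabanLadder.UV` only.  Restate-immune (no Theses import).
-/

noncomputable section

namespace Summit.QuantumFields.YangMills.BalabanUVNodes.N15.Gluing

open Real
open Literature.MathematicalPhysics.QuantumFieldTheory.Balaban1983to89
open Literature.MathematicalPhysics.QuantumFieldTheory.Balaban1983to89.B5Prop11Plancherel (Tor fine)
open Literature.MathematicalPhysics.QuantumFieldTheory.Balaban1983to89.B6Prop26Gluing (mulOp)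
open Summit.QuantumFields.YangMills.BalabanUVNodes.N15.BackgroundLayer (fgrad bgrad fgrad_apply bgrad_apply)
open Summit.QuantumFields.YangMills.BalabanUVNodes.N15.VectorPiece (bshiftEquiv kingPrV)
open Summit.QuantumFields.YangMills.BalabanUVNodes.N15.MatrixSpecies (liftMap liftEquiv liftEquiv_apply liftEquiv_symm_apply)
open Summit.QuantumFields.YangMills.BalabanUVNodes.N15.TwoGrid (chiCube)

variable {d : ℕ}

/-! ## §1 The lifted coordinate data and the lifted window -/

section Data

variable {M : Fin (d + 1) → ℕ} [∀ μ, NeZero (M μ)] {n w q m₀ S : ℕ} [NeZero n] (R : ℝ) (ι : Type)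

/-- FILE 66's shift compatibility read through the first factor: the lifted coordinates `ξ_ν(p) = coverXi M n w ν p.1` move by `(nw)⁻¹` (mod `2q`) under `liftEquiv (bshiftEquiv M n μ) ι`. [folklore] -/
theorem coverXi_shift_lift (hM : ∀ ν, M ν = 2 * q * w) (hw : 0 < w) (μ ν : Fin (d + 1)) (p : (Tor (fine n M) × Fin (d + 1)) × ι) :
    ∃ z : ℤ, (fun ν (p : (Tor (fine n M) × Fin (d + 1)) × ι) => coverXi M n w ν p.1) ν ((fun μ => liftEquiv (bshiftEquiv M n μ) ι) μ p) =
      (fun ν (p : (Tor (fine n M) × Fin (d + 1)) × ι) => coverXi M n w ν p.1) ν p + (if ν = μ then ((n : ℝ) * w)⁻¹ else 0) + (z : ℝ) * ((2 * q : ℕ) : ℝ) := by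
  simp only [liftEquiv_apply]
  exact coverXi_shift hM hw μ ν p.1

/-- ★ **THE LIFTED WINDOW**: FILE II §3's cut hypothesis for `χ := fun p => χ_k p.1` on the lifted carrier (FILE V `chiCube_coverCorner_eq_one_of_near_bbox` at `p.1`; window `Rw ≤ m₀`,
`m₀ + (R+2)w + 1 ≤ S ≤ 2qw`). [cite: Balaban1984PropagatorsII, (2.37) p.229 (shape)] -/
theorem chiCube_cover_lift_eq_one_of_near_bbox (hM : ∀ ν, M ν = 2 * q * w) (hw : 0 < w) (hlo : R * w ≤ m₀) (hhi : (m₀ : ℝ) + w + (R + 1) * w + 1 ≤ S) (hS : S ≤ 2 * q * w)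
    (μ : Fin (d + 1)) (k : Fin (d + 1) → ZMod (2 * q)) (p : (Tor (fine n M) × Fin (d + 1)) × ι)
    (hp : ∃ p₀ : (Tor (fine n M) × Fin (d + 1)) × ι, (p₀ = p ∨ p₀ = (fun μ => liftEquiv (bshiftEquiv M n μ) ι) μ p ∨ p₀ = ((fun μ => liftEquiv (bshiftEquiv M n μ) ι) μ).symm p) ∧
      ∀ ν, |cenRep (2 * q) ((fun ν (p : (Tor (fine n M) × Fin (d + 1)) × ι) => coverXi M n w ν p.1) ν p₀ - ((k ν).val : ℝ))| < R + 1) :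
    (fun p : (Tor (fine n M) × Fin (d + 1)) × ι => chiCube M n (coverCorner M w q m₀ k) S p.1) p = 1 := by
  obtain ⟨p₀, hp₀, hc⟩ := hp
  refine chiCube_coverCorner_eq_one_of_near_bbox R hM hw hlo hhi hS μ k p.1 ⟨p₀.1, ?_, hc⟩
  rcases hp₀ with rfl | rfl | rfl
  · exact Or.inl rfl
  · exact Or.inr (Or.inl (by simp only [liftEquiv_apply]))
  · exact Or.inr (Or.inr (by simp only [liftEquiv_symm_apply]))

end Data

/-! ## §2 One grid, lifted: `hdχt`∕`hdχtb`, the ten cut identities, `hL` -/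

section OneGrid

variable {M : Fin (d + 1) → ℕ} [∀ μ, NeZero (M μ)] {n w q m₀ S : ℕ} [NeZero n] (R : ℝ) (ι : Type)

/-- ★ **`hdχt` LIFTED**: `|fgrad n (liftEquiv (bshiftEquiv M n μ) ι) (fun p => χ̃_k p.1) p| ≤ π∕w`. [cite: Balaban1985BackgroundPropagators, (3.62)–(3.65) pp.402–403 (shape)] -/
theorem abs_fgrad_bcube_cover_lift_le (hM : ∀ ν, M ν = 2 * q * w) (hw : 0 < w) (k : Fin (d + 1) → ZMod (2 * q)) (μ : Fin (d + 1)) (p : (Tor (fine n M) × Fin (d + 1)) × ι) :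
    |fgrad (n : ℝ) (liftEquiv (bshiftEquiv M n μ) ι) (fun p : (Tor (fine n M) × Fin (d + 1)) × ι => bcube (2 * q) (coverXi M n w) R k p.1) p| ≤ π / w := by
  have h := abs_fgrad_bcube_cover_le R hM hw k μ p.1
  simpa only [fgrad_apply, liftEquiv_apply] using h

/-- ★ **`hdχtb` LIFTED**: `|bgrad n (liftEquiv (bshiftEquiv M n μ) ι) (fun p => χ̃_k p.1) p| ≤ π∕w`. [cite: Balaban1985BackgroundPropagators, (3.62)–(3.65) pp.402–403 (shape)] -/
theorem abs_bgrad_bcube_cover_lift_le (hM : ∀ ν, M ν = 2 * q * w) (hw : 0 < w) (k : Fin (d + 1) → ZMod (2 * q)) (μ : Fin (d + 1)) (p : (Tor (fine n M) × Fin (d + 1)) × ι) :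
    |bgrad (n : ℝ) (liftEquiv (bshiftEquiv M n μ) ι) (fun p : (Tor (fine n M) × Fin (d + 1)) × ι => bcube (2 * q) (coverXi M n w) R k p.1) p| ≤ π / w := by
  have h := abs_bgrad_bcube_cover_le R hM hw k μ p.1
  simpa only [bgrad_apply, liftEquiv_symm_apply] using h

/-- ★★ `hsub` LIFTED: `M_{χ̃_k∘fst}∘M_{χ_k∘fst} = M_{χ̃_k∘fst}`. [cite: Balaban1985BackgroundPropagators, (3.62)–(3.65) pp.402–403 (shape)] -/
theorem bcube_cover_lift_cut (hM : ∀ ν, M ν = 2 * q * w) (hw : 0 < w) (hlo : R * w ≤ m₀) (hhi : (m₀ : ℝ) + w + (R + 1) * w + 1 ≤ S) (hS : S ≤ 2 * q * w) (k : Fin (d + 1) → ZMod (2 * q)) :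
    mulOp (fun p : (Tor (fine n M) × Fin (d + 1)) × ι => bcube (2 * q) (coverXi M n w) R k p.1) ∘ₗ mulOp (fun p : (Tor (fine n M) × Fin (d + 1)) × ι => chiCube M n (coverCorner M w q m₀ k) S p.1) =
      mulOp (fun p : (Tor (fine n M) × Fin (d + 1)) × ι => bcube (2 * q) (coverXi M n w) R k p.1) :=
  bcube_cut (2 * q) (fun ν (p : (Tor (fine n M) × Fin (d + 1)) × ι) => coverXi M n w ν p.1) R (fun μ => liftEquiv (bshiftEquiv M n μ) ι) 0
    (chiCube_cover_lift_eq_one_of_near_bbox R ι hM hw hlo hhi hS 0 k)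

/-- ★★ `hχ` LIFTED: `M_{χ_k∘fst}∘M_{χ̃_k∘fst} = M_{χ̃_k∘fst}`. [folklore] -/
theorem cut_bcube_cover_lift (hM : ∀ ν, M ν = 2 * q * w) (hw : 0 < w) (hlo : R * w ≤ m₀) (hhi : (m₀ : ℝ) + w + (R + 1) * w + 1 ≤ S) (hS : S ≤ 2 * q * w) (k : Fin (d + 1) → ZMod (2 * q)) :
    mulOp (fun p : (Tor (fine n M) × Fin (d + 1)) × ι => chiCube M n (coverCorner M w q m₀ k) S p.1) ∘ₗ mulOp (fun p : (Tor (fine n M) × Fin (d + 1)) × ι => bcube (2 * q) (coverXi M n w) R k p.1) =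
      mulOp (fun p : (Tor (fine n M) × Fin (d + 1)) × ι => bcube (2 * q) (coverXi M n w) R k p.1) :=
  cut_bcube (2 * q) (fun ν (p : (Tor (fine n M) × Fin (d + 1)) × ι) => coverXi M n w ν p.1) R (fun μ => liftEquiv (bshiftEquiv M n μ) ι) 0
    (chiCube_cover_lift_eq_one_of_near_bbox R ι hM hw hlo hhi hS 0 k)

/-- ★★ `hs` LIFTED: `M_{(χ̃_k∘fst)∘τ̂_μ}∘M_{χ_k∘fst} = M_{(χ̃_k∘fst)∘τ̂_μ}`, `τ̂_μ = liftEquiv (bshiftEquiv M n μ) ι`. [folklore] -/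
theorem bcube_cover_lift_comp_shift_cut (hM : ∀ ν, M ν = 2 * q * w) (hw : 0 < w) (hlo : R * w ≤ m₀) (hhi : (m₀ : ℝ) + w + (R + 1) * w + 1 ≤ S) (hS : S ≤ 2 * q * w)
    (k : Fin (d + 1) → ZMod (2 * q)) (μ : Fin (d + 1)) :
    mulOp ((fun p : (Tor (fine n M) × Fin (d + 1)) × ι => bcube (2 * q) (coverXi M n w) R k p.1) ∘ (liftEquiv (bshiftEquiv M n μ) ι)) ∘ₗ
        mulOp (fun p : (Tor (fine n M) × Fin (d + 1)) × ι => chiCube M n (coverCorner M w q m₀ k) S p.1) =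
      mulOp ((fun p : (Tor (fine n M) × Fin (d + 1)) × ι => bcube (2 * q) (coverXi M n w) R k p.1) ∘ (liftEquiv (bshiftEquiv M n μ) ι)) :=
  bcube_comp_shift_cut (2 * q) (fun ν (p : (Tor (fine n M) × Fin (d + 1)) × ι) => coverXi M n w ν p.1) R (fun μ => liftEquiv (bshiftEquiv M n μ) ι) μ
    (chiCube_cover_lift_eq_one_of_near_bbox R ι hM hw hlo hhi hS μ k)

/-- ★★ `hs2` (`hs′` of file 44) LIFTED: `M_{χ_k∘fst}∘M_{(χ̃_k∘fst)∘τ̂_μ} = M_{(χ̃_k∘fst)∘τ̂_μ}`. [folklore] -/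
theorem cut_bcube_cover_lift_comp_shift (hM : ∀ ν, M ν = 2 * q * w) (hw : 0 < w) (hlo : R * w ≤ m₀) (hhi : (m₀ : ℝ) + w + (R + 1) * w + 1 ≤ S) (hS : S ≤ 2 * q * w)
    (k : Fin (d + 1) → ZMod (2 * q)) (μ : Fin (d + 1)) :
    mulOp (fun p : (Tor (fine n M) × Fin (d + 1)) × ι => chiCube M n (coverCorner M w q m₀ k) S p.1) ∘ₗ
        mulOp ((fun p : (Tor (fine n M) × Fin (d + 1)) × ι => bcube (2 * q) (coverXi M n w) R k p.1) ∘ (liftEquiv (bshiftEquiv M n μ) ι)) =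
      mulOp ((fun p : (Tor (fine n M) × Fin (d + 1)) × ι => bcube (2 * q) (coverXi M n w) R k p.1) ∘ (liftEquiv (bshiftEquiv M n μ) ι)) :=
  cut_bcube_comp_shift (2 * q) (fun ν (p : (Tor (fine n M) × Fin (d + 1)) × ι) => coverXi M n w ν p.1) R (fun μ => liftEquiv (bshiftEquiv M n μ) ι) μ
    (chiCube_cover_lift_eq_one_of_near_bbox R ι hM hw hlo hhi hS μ k)

/-- ★★ `hsb` LIFTED: `M_{(χ̃_k∘fst)∘τ̂_μ⁻¹}∘M_{χ_k∘fst} = M_{(χ̃_k∘fst)∘τ̂_μ⁻¹}`. [folklore] -/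
theorem bcube_cover_lift_comp_shift_symm_cut (hM : ∀ ν, M ν = 2 * q * w) (hw : 0 < w) (hlo : R * w ≤ m₀) (hhi : (m₀ : ℝ) + w + (R + 1) * w + 1 ≤ S) (hS : S ≤ 2 * q * w)
    (k : Fin (d + 1) → ZMod (2 * q)) (μ : Fin (d + 1)) :
    mulOp ((fun p : (Tor (fine n M) × Fin (d + 1)) × ι => bcube (2 * q) (coverXi M n w) R k p.1) ∘ (liftEquiv (bshiftEquiv M n μ) ι).symm) ∘ₗ
        mulOp (fun p : (Tor (fine n M) × Fin (d + 1)) × ι => chiCube M n (coverCorner M w q m₀ k) S p.1) =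
      mulOp ((fun p : (Tor (fine n M) × Fin (d + 1)) × ι => bcube (2 * q) (coverXi M n w) R k p.1) ∘ (liftEquiv (bshiftEquiv M n μ) ι).symm) :=
  bcube_comp_shift_symm_cut (2 * q) (fun ν (p : (Tor (fine n M) × Fin (d + 1)) × ι) => coverXi M n w ν p.1) R (fun μ => liftEquiv (bshiftEquiv M n μ) ι) μ
    (chiCube_cover_lift_eq_one_of_near_bbox R ι hM hw hlo hhi hS μ k)

/-- ★★ `hsb2` (`hsb′` of file 44) LIFTED: `M_{χ_k∘fst}∘M_{(χ̃_k∘fst)∘τ̂_μ⁻¹} = M_{(χ̃_k∘fst)∘τ̂_μ⁻¹}`. [folklore] -/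
theorem cut_bcube_cover_lift_comp_shift_symm (hM : ∀ ν, M ν = 2 * q * w) (hw : 0 < w) (hlo : R * w ≤ m₀) (hhi : (m₀ : ℝ) + w + (R + 1) * w + 1 ≤ S) (hS : S ≤ 2 * q * w)
    (k : Fin (d + 1) → ZMod (2 * q)) (μ : Fin (d + 1)) :
    mulOp (fun p : (Tor (fine n M) × Fin (d + 1)) × ι => chiCube M n (coverCorner M w q m₀ k) S p.1) ∘ₗ
        mulOp ((fun p : (Tor (fine n M) × Fin (d + 1)) × ι => bcube (2 * q) (coverXi M n w) R k p.1) ∘ (liftEquiv (bshiftEquiv M n μ) ι).symm) =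
      mulOp ((fun p : (Tor (fine n M) × Fin (d + 1)) × ι => bcube (2 * q) (coverXi M n w) R k p.1) ∘ (liftEquiv (bshiftEquiv M n μ) ι).symm) :=
  cut_bcube_comp_shift_symm (2 * q) (fun ν (p : (Tor (fine n M) × Fin (d + 1)) × ι) => coverXi M n w ν p.1) R (fun μ => liftEquiv (bshiftEquiv M n μ) ι) μ
    (chiCube_cover_lift_eq_one_of_near_bbox R ι hM hw hlo hhi hS μ k)

/-- ★★ `hdd` LIFTED: `M_{∇̂_μ(χ̃_k∘fst)}∘M_{χ_k∘fst} = M_{∇̂_μ(χ̃_k∘fst)}`, any weight `a`. [folklore] -/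
theorem fgrad_bcube_cover_lift_cut (hM : ∀ ν, M ν = 2 * q * w) (hw : 0 < w) (hlo : R * w ≤ m₀) (hhi : (m₀ : ℝ) + w + (R + 1) * w + 1 ≤ S) (hS : S ≤ 2 * q * w) (a : ℝ)
    (k : Fin (d + 1) → ZMod (2 * q)) (μ : Fin (d + 1)) :
    mulOp (fgrad a (liftEquiv (bshiftEquiv M n μ) ι) (fun p : (Tor (fine n M) × Fin (d + 1)) × ι => bcube (2 * q) (coverXi M n w) R k p.1)) ∘ₗ
        mulOp (fun p : (Tor (fine n M) × Fin (d + 1)) × ι => chiCube M n (coverCorner M w q m₀ k) S p.1) =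
      mulOp (fgrad a (liftEquiv (bshiftEquiv M n μ) ι) (fun p : (Tor (fine n M) × Fin (d + 1)) × ι => bcube (2 * q) (coverXi M n w) R k p.1)) :=
  fgrad_bcube_cut (2 * q) (fun ν (p : (Tor (fine n M) × Fin (d + 1)) × ι) => coverXi M n w ν p.1) R (fun μ => liftEquiv (bshiftEquiv M n μ) ι) μ a
    (chiCube_cover_lift_eq_one_of_near_bbox R ι hM hw hlo hhi hS μ k)

/-- ★★ `hdd2` (`hdd′` of file 44) LIFTED: `M_{χ_k∘fst}∘M_{∇̂_μ(χ̃_k∘fst)} = M_{∇̂_μ(χ̃_k∘fst)}`. [folklore] -/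
theorem cut_fgrad_bcube_cover_lift (hM : ∀ ν, M ν = 2 * q * w) (hw : 0 < w) (hlo : R * w ≤ m₀) (hhi : (m₀ : ℝ) + w + (R + 1) * w + 1 ≤ S) (hS : S ≤ 2 * q * w) (a : ℝ)
    (k : Fin (d + 1) → ZMod (2 * q)) (μ : Fin (d + 1)) :
    mulOp (fun p : (Tor (fine n M) × Fin (d + 1)) × ι => chiCube M n (coverCorner M w q m₀ k) S p.1) ∘ₗ
        mulOp (fgrad a (liftEquiv (bshiftEquiv M n μ) ι) (fun p : (Tor (fine n M) × Fin (d + 1)) × ι => bcube (2 * q) (coverXi M n w) R k p.1)) =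
      mulOp (fgrad a (liftEquiv (bshiftEquiv M n μ) ι) (fun p : (Tor (fine n M) × Fin (d + 1)) × ι => bcube (2 * q) (coverXi M n w) R k p.1)) :=
  cut_fgrad_bcube (2 * q) (fun ν (p : (Tor (fine n M) × Fin (d + 1)) × ι) => coverXi M n w ν p.1) R (fun μ => liftEquiv (bshiftEquiv M n μ) ι) μ a
    (chiCube_cover_lift_eq_one_of_near_bbox R ι hM hw hlo hhi hS μ k)

/-- ★★ `hddb` LIFTED: `M_{∇̂⁻_μ(χ̃_k∘fst)}∘M_{χ_k∘fst} = M_{∇̂⁻_μ(χ̃_k∘fst)}`. [folklore] -/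
theorem bgrad_bcube_cover_lift_cut (hM : ∀ ν, M ν = 2 * q * w) (hw : 0 < w) (hlo : R * w ≤ m₀) (hhi : (m₀ : ℝ) + w + (R + 1) * w + 1 ≤ S) (hS : S ≤ 2 * q * w) (a : ℝ)
    (k : Fin (d + 1) → ZMod (2 * q)) (μ : Fin (d + 1)) :
    mulOp (bgrad a (liftEquiv (bshiftEquiv M n μ) ι) (fun p : (Tor (fine n M) × Fin (d + 1)) × ι => bcube (2 * q) (coverXi M n w) R k p.1)) ∘ₗ
        mulOp (fun p : (Tor (fine n M) × Fin (d + 1)) × ι => chiCube M n (coverCorner M w q m₀ k) S p.1) =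
      mulOp (bgrad a (liftEquiv (bshiftEquiv M n μ) ι) (fun p : (Tor (fine n M) × Fin (d + 1)) × ι => bcube (2 * q) (coverXi M n w) R k p.1)) :=
  bgrad_bcube_cut (2 * q) (fun ν (p : (Tor (fine n M) × Fin (d + 1)) × ι) => coverXi M n w ν p.1) R (fun μ => liftEquiv (bshiftEquiv M n μ) ι) μ a
    (chiCube_cover_lift_eq_one_of_near_bbox R ι hM hw hlo hhi hS μ k)

/-- ★★ `hddb2` (`hddb′` of file 44) LIFTED: `M_{χ_k∘fst}∘M_{∇̂⁻_μ(χ̃_k∘fst)} = M_{∇̂⁻_μ(χ̃_k∘fst)}`. [folklore] -/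
theorem cut_bgrad_bcube_cover_lift (hM : ∀ ν, M ν = 2 * q * w) (hw : 0 < w) (hlo : R * w ≤ m₀) (hhi : (m₀ : ℝ) + w + (R + 1) * w + 1 ≤ S) (hS : S ≤ 2 * q * w) (a : ℝ)
    (k : Fin (d + 1) → ZMod (2 * q)) (μ : Fin (d + 1)) :
    mulOp (fun p : (Tor (fine n M) × Fin (d + 1)) × ι => chiCube M n (coverCorner M w q m₀ k) S p.1) ∘ₗ
        mulOp (bgrad a (liftEquiv (bshiftEquiv M n μ) ι) (fun p : (Tor (fine n M) × Fin (d + 1)) × ι => bcube (2 * q) (coverXi M n w) R k p.1)) =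
      mulOp (bgrad a (liftEquiv (bshiftEquiv M n μ) ι) (fun p : (Tor (fine n M) × Fin (d + 1)) × ι => bcube (2 * q) (coverXi M n w) R k p.1)) :=
  cut_bgrad_bcube (2 * q) (fun ν (p : (Tor (fine n M) × Fin (d + 1)) × ι) => coverXi M n w ν p.1) R (fun μ => liftEquiv (bshiftEquiv M n μ) ι) μ a
    (chiCube_cover_lift_eq_one_of_near_bbox R ι hM hw hlo hhi hS μ k)

/-- ★★★ **files 44∕47's `hL` ON THE LIFTED COVER**: `R ≥ 1 + (nw)⁻¹` and the displayed locality `M_{h_k∘fst}∘W∘M_{1−χ̃_k∘fst} = 0` ⟹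
`M_{h_k∘fst}∘lapOp a (fun μ => liftEquiv (bshiftEquiv M n μ) ι) W∘M_{1−χ̃_k∘fst} = 0` (FILE II `mulOp_hcube_comp_lapOp_comp_one_sub_bcube` on the lifted carrier).
[cite: Balaban1984PropagatorsII, (2.91) p.239 (mechanism); Balaban1985BackgroundPropagators, (3.26) p.395, (3.62)–(3.65) pp.402–403 (shape)] -/
theorem mulOp_coverH_lift_comp_lapOp_comp_one_sub_bcube_cover_lift (hM : ∀ ν, M ν = 2 * q * w) (hw : 0 < w) (hR : 1 + |((n : ℝ) * w)⁻¹| ≤ R) (a : ℝ)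
    (W : ((Tor (fine n M) × Fin (d + 1)) × ι → ℝ) →ₗ[ℝ] ((Tor (fine n M) × Fin (d + 1)) × ι → ℝ)) (k : Fin (d + 1) → ZMod (2 * q))
    (hW : mulOp (fun p : (Tor (fine n M) × Fin (d + 1)) × ι => hcube (2 * q) (coverXi M n w) k p.1) ∘ₗ W ∘ₗ
      mulOp (1 - fun p : (Tor (fine n M) × Fin (d + 1)) × ι => bcube (2 * q) (coverXi M n w) R k p.1) = 0) :
    mulOp (fun p : (Tor (fine n M) × Fin (d + 1)) × ι => hcube (2 * q) (coverXi M n w) k p.1) ∘ₗ lapOp a (fun μ => liftEquiv (bshiftEquiv M n μ) ι) W ∘ₗ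
      mulOp (1 - fun p : (Tor (fine n M) × Fin (d + 1)) × ι => bcube (2 * q) (coverXi M n w) R k p.1) = 0 :=
  mulOp_hcube_comp_lapOp_comp_one_sub_bcube (2 * q) (fun ν (p : (Tor (fine n M) × Fin (d + 1)) × ι) => coverXi M n w ν p.1) R (fun μ => liftEquiv (bshiftEquiv M n μ) ι)
    (two_mul_q_pos_of_cover hM) (coverXi_shift_lift ι hM hw) hR a W k hW

/-- ★★ **`hL` LIFTED, HYPOTHESIS-FREE FOR A MULTIPLICATION OPERATOR** `W = M_v`: `M_{h_k∘fst}∘(Σ_μ∇̂*_μ∇̂_μ + M_v)∘M_{1−χ̃_k∘fst} = 0` (`R ≥ 1 + (nw)⁻¹`). [cite: Balaban1985BackgroundPropagators, (3.26) p.395 (shape)] -/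
theorem mulOp_coverH_lift_comp_lapOp_mulOp_comp_one_sub_bcube_cover_lift (hM : ∀ ν, M ν = 2 * q * w) (hw : 0 < w) (hR : 1 + |((n : ℝ) * w)⁻¹| ≤ R) (a : ℝ)
    (v : (Tor (fine n M) × Fin (d + 1)) × ι → ℝ) (k : Fin (d + 1) → ZMod (2 * q)) :
    mulOp (fun p : (Tor (fine n M) × Fin (d + 1)) × ι => hcube (2 * q) (coverXi M n w) k p.1) ∘ₗ lapOp a (fun μ => liftEquiv (bshiftEquiv M n μ) ι) (mulOp v) ∘ₗ
      mulOp (1 - fun p : (Tor (fine n M) × Fin (d + 1)) × ι => bcube (2 * q) (coverXi M n w) R k p.1) = 0 :=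
  mulOp_hcube_comp_lapOp_mulOp_comp_one_sub_bcube (2 * q) (fun ν (p : (Tor (fine n M) × Fin (d + 1)) × ι) => coverXi M n w ν p.1) R (fun μ => liftEquiv (bshiftEquiv M n μ) ι)
    (two_mul_q_pos_of_cover hM) (coverXi_shift_lift ι hM hw) hR a v k

end OneGrid

/-! ## §3 Two spacings, lifted: `hfit₁`∕`hfit₁b`∕`hfit₂`∕`hfit₂b` along `liftMap (kingPrV L k r M) ι` -/

section TwoGrid

variable {M : Fin (d + 1) → ℕ} [∀ μ, NeZero (M μ)] {L kk r w q : ℕ} [NeZero L] (R : ℝ) (ι : Type)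

/-- ★★ **`hfit₁` LIFTED**: `|(χ̃′_k∘fst)(τ̂′_μ p′) − (χ̃_k∘fst)(τ̂_μ(π̂ p′))| ≤ π(d+1)∕(L^k w)` (FILE VI `abs_bcube_cover_shift_fine_sub_le` at `p′.1`).
[cite: Balaban1985BackgroundPropagators, (3.62)–(3.65) pp.402–403 (shape), Thm 3.14 pp.426–427 (difference template)] -/
theorem abs_bcube_cover_lift_shift_fine_sub_le (hM : ∀ ν, M ν = 2 * q * w) (hw : 0 < w) (k : Fin (d + 1) → ZMod (2 * q)) (μ : Fin (d + 1))
    (p' : (Tor (fine (L ^ r * L ^ kk) M) × Fin (d + 1)) × ι) :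
    |((fun p' : (Tor (fine (L ^ r * L ^ kk) M) × Fin (d + 1)) × ι => bcube (2 * q) (coverXi M (L ^ r * L ^ kk) w) R k p'.1) ∘ (liftEquiv (bshiftEquiv M (L ^ r * L ^ kk) μ) ι)) p' -
        ((fun p : (Tor (fine (L ^ kk) M) × Fin (d + 1)) × ι => bcube (2 * q) (coverXi M (L ^ kk) w) R k p.1) ∘ (liftEquiv (bshiftEquiv M (L ^ kk) μ) ι)) (liftMap (kingPrV L kk r M) ι p')|
      ≤ π * (d + 1) / (((L ^ kk : ℕ) : ℝ) * w) := by
  have h := abs_bcube_cover_shift_fine_sub_le (L := L) (kk := kk) (r := r) R hM hw k μ p'.1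
  simpa only [Function.comp_apply, liftEquiv_apply, liftMap] using h

/-- ★★ **`hfit₁b` LIFTED**: `|(χ̃′_k∘fst)(τ̂′_μ⁻¹ p′) − (χ̃_k∘fst)(τ̂_μ⁻¹(π̂ p′))| ≤ 2π(d+1)∕(L^k w)` (FILE VI `abs_bcube_cover_shift_symm_fine_sub_le`).
[cite: Balaban1985BackgroundPropagators, (3.62)–(3.65) pp.402–403 (shape), Thm 3.14 pp.426–427 (difference template)] -/
theorem abs_bcube_cover_lift_shift_symm_fine_sub_le (hM : ∀ ν, M ν = 2 * q * w) (hw : 0 < w) (k : Fin (d + 1) → ZMod (2 * q)) (μ : Fin (d + 1))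
    (p' : (Tor (fine (L ^ r * L ^ kk) M) × Fin (d + 1)) × ι) :
    |((fun p' : (Tor (fine (L ^ r * L ^ kk) M) × Fin (d + 1)) × ι => bcube (2 * q) (coverXi M (L ^ r * L ^ kk) w) R k p'.1) ∘ (liftEquiv (bshiftEquiv M (L ^ r * L ^ kk) μ) ι).symm) p' -
        ((fun p : (Tor (fine (L ^ kk) M) × Fin (d + 1)) × ι => bcube (2 * q) (coverXi M (L ^ kk) w) R k p.1) ∘ (liftEquiv (bshiftEquiv M (L ^ kk) μ) ι).symm)
          (liftMap (kingPrV L kk r M) ι p')| ≤ 2 * (π * (d + 1) / (((L ^ kk : ℕ) : ℝ) * w)) := by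
  have h := abs_bcube_cover_shift_symm_fine_sub_le (L := L) (kk := kk) (r := r) R hM hw k μ p'.1
  simpa only [Function.comp_apply, liftEquiv_symm_apply, liftMap] using h

/-- ★★★ **`hfit₂` LIFTED**: `|fgrad n′ τ̂′_μ (χ̃′_k∘fst) p′ − fgrad n τ̂_μ (χ̃_k∘fst) (π̂ p′)| ≤ w⁻¹(L^k w)⁻¹(32π⁴ + π²(d+1))` (FILE VI `abs_fgrad_bcube_cover_two_grid_le` at `p′.1`;
`0 ≤ R`, `2R + 4 ≤ 2q`). [cite: Balaban1985BackgroundPropagators, (3.62)–(3.65) pp.402–403 (shape), Thm 3.14 pp.426–427 (difference template)] -/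
theorem abs_fgrad_bcube_cover_lift_two_grid_le (hM : ∀ ν, M ν = 2 * q * w) (hw : 0 < w) (hR : 0 ≤ R) (hRq : 2 * R + 4 ≤ ((2 * q : ℕ) : ℝ)) (k : Fin (d + 1) → ZMod (2 * q))
    (μ : Fin (d + 1)) (p' : (Tor (fine (L ^ r * L ^ kk) M) × Fin (d + 1)) × ι) :
    |fgrad ((L ^ r * L ^ kk : ℕ) : ℝ) (liftEquiv (bshiftEquiv M (L ^ r * L ^ kk) μ) ι)
          (fun p' : (Tor (fine (L ^ r * L ^ kk) M) × Fin (d + 1)) × ι => bcube (2 * q) (coverXi M (L ^ r * L ^ kk) w) R k p'.1) p' -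
        fgrad ((L ^ kk : ℕ) : ℝ) (liftEquiv (bshiftEquiv M (L ^ kk) μ) ι)
          (fun p : (Tor (fine (L ^ kk) M) × Fin (d + 1)) × ι => bcube (2 * q) (coverXi M (L ^ kk) w) R k p.1) (liftMap (kingPrV L kk r M) ι p')|
      ≤ ((w : ℝ))⁻¹ * (((L ^ kk : ℕ) : ℝ) * w)⁻¹ * (32 * π ^ 4 + π ^ 2 * (d + 1)) := by
  have h := abs_fgrad_bcube_cover_two_grid_le (L := L) (kk := kk) (r := r) R hM hw hR hRq k μ p'.1
  simpa only [fgrad_apply, liftEquiv_apply, liftMap] using h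

/-- ★★★ **`hfit₂b` LIFTED**: `|bgrad n′ τ̂′_μ (χ̃′_k∘fst) p′ − bgrad n τ̂_μ (χ̃_k∘fst) (π̂ p′)| ≤ w⁻¹(L^k w)⁻¹(32π⁴ + π²(d+1))` (FILE VI `abs_bgrad_bcube_cover_two_grid_le`).
[cite: Balaban1985BackgroundPropagators, (3.62)–(3.65) pp.402–403 (shape), Thm 3.14 pp.426–427 (difference template)] -/
theorem abs_bgrad_bcube_cover_lift_two_grid_le (hM : ∀ ν, M ν = 2 * q * w) (hw : 0 < w) (hR : 0 ≤ R) (hRq : 2 * R + 4 ≤ ((2 * q : ℕ) : ℝ)) (k : Fin (d + 1) → ZMod (2 * q))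
    (μ : Fin (d + 1)) (p' : (Tor (fine (L ^ r * L ^ kk) M) × Fin (d + 1)) × ι) :
    |bgrad ((L ^ r * L ^ kk : ℕ) : ℝ) (liftEquiv (bshiftEquiv M (L ^ r * L ^ kk) μ) ι)
          (fun p' : (Tor (fine (L ^ r * L ^ kk) M) × Fin (d + 1)) × ι => bcube (2 * q) (coverXi M (L ^ r * L ^ kk) w) R k p'.1) p' -
        bgrad ((L ^ kk : ℕ) : ℝ) (liftEquiv (bshiftEquiv M (L ^ kk) μ) ι)
          (fun p : (Tor (fine (L ^ kk) M) × Fin (d + 1)) × ι => bcube (2 * q) (coverXi M (L ^ kk) w) R k p.1) (liftMap (kingPrV L kk r M) ι p')|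
      ≤ ((w : ℝ))⁻¹ * (((L ^ kk : ℕ) : ℝ) * w)⁻¹ * (32 * π ^ 4 + π ^ 2 * (d + 1)) := by
  have h := abs_bgrad_bcube_cover_two_grid_le (L := L) (kk := kk) (r := r) R hM hw hR hRq k μ p'.1
  simpa only [bgrad_apply, liftEquiv_symm_apply, liftMap] using h

end TwoGrid

end Summit.QuantumFields.YangMills.BalabanUVNodes.N15.Gluing

end
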